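import Literature.Topology.FourManifolds.SphereSurgeryRelativeCohomology
import Literature.Topology.FourManifolds.SphereSurgeryOrientationTransfer
import Literature.Topology.FourManifolds.LatticeFormsPullbackSignature
import Literature.Topology.FourManifolds.HomotopySpheresSignatureConnectedSum
import Literature.Topology.FourManifolds.BoundarySignature
import HarnessLib

/-!
# The signature is not changed by a surgery below the middle dimension (index `≤ p - 2`)

Topic `Literature/Topology/FourManifolds` (fact seat of
`Literature.Topology.FourManifolds.HomotopySphere.exists_highlyConnected_of_mem_signatureSet`,
brick B6f: the `σ`-invariance input `h6` of `SurgeryBelowMiddleDimension.lean`, for spheres of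
dimension `k ≤ p - 2` in a `(p + p)`-manifold).  A. Kosinski, *Differential Manifolds* (1993),
Ch. X §3, Prop. (3.3), p. 206: "`σ(M)` is an invariant of cobordism" (in the sense of X §1: a
sequence of surgeries not touching `∂M`), the signature of a manifold bounded by a homotopy
sphere being that of the closed homology manifold `M ∪ cone(∂M)` (Kervaire–Milnor 1963, §7,
footnote pp. 528–529).  Kosinski's proof attaches the cone, invokes the topological Poincaré
conjecture to make the closed model a manifold, and cites Thom's cobordism invariance; the tree
has neither (Milnor's Prop. B is open there), so the invariance is proved here DIRECTLY and
WITHOUT duality, through the common collapse `Z = U⁺` of the two closed models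
(`SphereSurgeryCollapse.lean`) and the compact part `K₀` of `U` off the tube and off a thin collar
(`SphereSurgeryEnds.lean`, `SphereSurgeryRelativeCohomology.lean`):

  `Hᵖ(Ŵ)/T ↞ Hᵖ(Ŵ) ↞ Hᵖ(Ŵ, Ŵ ∖ ι_X K₀) ≅ Hᵖ(Z, Z ∖ K₀) ≅ Hᵖ(χ̂, χ̂ ∖ ι_P K₀) ↠ Hᵖ(χ̂) ↠ Hᵖ(χ̂)/T`

(excision; `Hᵖ(Ŵ ∖ ι_X K₀) = Hᵖ(T̂ ⊔ N) = 0` as `T̂ ≃ Sᵏ`, `k < p`; `Hᵖ⁻¹, Hᵖ(χ̂ ∖ ι_P K₀) = 0` as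
`T̂' ≃ Sˡ`, `l > p`), all maps being isometric for the cup product pairings `⟨a ⌣ b, [·]⟩` — on
`Hᵖ(Z, Z ∖ K₀)` the two pulled-back pairings AGREE because `π_* [Ŵ]` and `π'_* [χ̂]` differ by a
class coming from `Z ∖ K₀`, on which these relative classes vanish
(`kroneckerPairing_cupProduct_map_collapse_eq`) — and the index `τ = b⁺ - b⁻` of a form being
unchanged under pull-back along a surjection (`LatticeFormsPullbackSignature.lean`).

* `NullCobordism.signatureInDim_surgery_eq_of_lt` — **for `k + 1 < p`, `p + p = dim W`, and
  oriented-boundary data `(M, μ) = bW` (`c.IsOrientedBy μ μ'`), the surgered null-cobordism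
  carries `μ''` with `(M, μ) = bχ` and `σ(χ̂, μ'') = σ(Ŵ, μ')`.**

Everything is proved; no definitions, no named facts.  (The remaining index `k = p - 1`, where
`Hᵖ⁻¹(T̂) ≅ ℤ ≅ Hᵖ(T̂')` and the two outer maps have cyclic kernel and cokernel, is treated
separately.)

## References

* A. Kosinski, *Differential Manifolds* (1993), Ch. X §3, Prop. (3.3), p. 206; §1 (cobordism by
  surgeries). [Kosinski1993]
* M. Kervaire, J. Milnor, *Groups of homotopy spheres I*, Ann. of Math. 77 (1963), §5
  (Lemma 5.6), §7 footnote pp. 528–529. [KervaireMilnorAnnals1963]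
* J.-P. Serre, *A Course in Arithmetic* (1973), Ch. IV §1.2–§1.4, Ch. V §1.3.2. [Serre1973]
* A. Hatcher, *Algebraic Topology* (2002), Thm. 2.20, §3.1 pp. 199–204, Prop. 3.10. [HatcherAT2002]
-/

noncomputable section

open scoped Manifold ContDiff Topology
open Set Function Filter CategoryTheory Limits Topology Metric
open Literature.AlgebraicTopology.SingularHomology

namespace Literature.AlgebraicTopology.SingularHomology

namespace relSingularCohomology

variable {R : Type} [CommRing R] {G : Type} [AddCommGroup G] [Module R G]
variable {X : Type} [TopologicalSpace X]

/-- `Hⁿ(X, A) → Hⁿ(X) → Hⁿ(A)` is zero (Hatcher 2002, §3.1 p. 200). [cite: HatcherAT2002, §3.1 p. 200] -/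
theorem toAbsolute_comp_map_subsetIncl (A : Set X) (n : ℕ) :
    toAbsolute R G X A n ≫ singularCohomology.map R G (subsetIncl A) n = 0 := by
  change HomologicalComplex.homologyMap (relShortComplex R G A).f n ≫
    HomologicalComplex.homologyMap (relShortComplex R G A).g n = 0
  rw [← HomologicalComplex.homologyMap_comp, (relShortComplex R G A).zero,
    HomologicalComplex.homologyMap_zero]

/-- Elementwise: a class coming from `Hⁿ(X, A)` vanishes on `A`. [cite: HatcherAT2002, §3.1 p. 200] -/
theorem map_subsetIncl_toAbsolute (A : Set X) (n : ℕ) (a : relSingularCohomology R G X A n) :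
    singularCohomology.map R G (subsetIncl A) n (toAbsolute R G X A n a) = 0 := by
  rw [← ModuleCat.comp_apply, toAbsolute_comp_map_subsetIncl]; rfl

/-- Elementwise naturality of `Hⁿ(X, A) → Hⁿ(X)`: `j^*(f^* a) = f^*(j^* a)`. [cite: HatcherAT2002, §3.1 p. 200] -/
theorem toAbsolute_map_apply {Y : Type} [TopologicalSpace Y] {A : Set X} {B : Set Y} (f : C(X, Y))
    (h : MapsTo f A B) (n : ℕ) (a : relSingularCohomology R G Y B n) :
    toAbsolute R G X A n (relSingularCohomology.map R G f h n a) =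
      singularCohomology.map R G f n (toAbsolute R G Y B n a) := by
  rw [← ModuleCat.comp_apply, map_comp_toAbsolute]; rfl

end relSingularCohomology

end Literature.AlgebraicTopology.SingularHomology

namespace Literature.Topology.FourManifolds

namespace NullCobordism

variable {m : ℕ}
variable {M : Type} [TopologicalSpace M] [ChartedSpace (EuclideanSpace ℝ (Fin (m + 1))) M]
  [IsManifold (𝓡 (m + 1)) ∞ M]
  (c : NullCobordism (m + 1) M) {ι : Type} [Unique ι] {k l : ℕ}
  (ν : FramedSphereFamily (𝓡∂ (m + 1 + 1)) c.W ι k (l + 1)) (hkl : k + l = m + 1)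

/-! ### §1 The pulled-back cup product pairing on `Hᵖ(Z, Z ∖ K)` -/

section Forms

/-- **The cup product pairing of `Ŵ` pulled back to `Hᵖ(Z, Z ∖ K)` along `π^*` and `Hᵖ(Ŵ, ·) → Hᵖ(Ŵ)`**:
`(a, b) ↦ ⟨j^* π^* a ⌣ j^* π^* b, [Ŵ]⟩ = ⟨j^* a ⌣ j^* b, π_* [Ŵ]⟩`. [cite: HatcherAT2002, Prop. 3.10 and §3.1 p. 201] -/
theorem cupPairing_toAbsolute_relMap_collapseX {p : ℕ} (hp : p + p = m + 1 + 1)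
    (μ' : HomologicalOrientation ℤ (ClosedModel (m + 1) c.W) (m + 1 + 1))
    (K : Set ↥(c.commonPiece ν)) (a b : relSingularCohomology ℤ ℤ (c.collapseTarget ν) ((c.ιZ ν '' K)ᶜ) p) :
    cupPairing μ' hp
        (relSingularCohomology.toAbsolute ℤ ℤ _ _ p
          (relSingularCohomology.map ℤ ℤ (c.collapseX ν hkl) (c.mapsTo_collapseX ν hkl K) p a))
        (relSingularCohomology.toAbsolute ℤ ℤ _ _ p
          (relSingularCohomology.map ℤ ℤ (c.collapseX ν hkl) (c.mapsTo_collapseX ν hkl K) p b)) =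
      kroneckerPairing ℤ ℤ (c.collapseTarget ν) (m + 1 + 1)
        (cupProduct hp (relSingularCohomology.toAbsolute ℤ ℤ _ _ p a)
          (relSingularCohomology.toAbsolute ℤ ℤ _ _ p b))
        (singularHomology.map ℤ ℤ (c.collapseX ν hkl) (m + 1 + 1) μ'.fundamentalClass) := by
  rw [cupPairing_apply, relSingularCohomology.toAbsolute_map_apply,
    relSingularCohomology.toAbsolute_map_apply, ← cupProduct_map, kroneckerPairing_map]

/-- The `χ̂` version of `cupPairing_toAbsolute_relMap_collapseX`. [cite: HatcherAT2002, Prop. 3.10 and §3.1 p. 201] -/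
theorem cupPairing_toAbsolute_relMap_collapseP {p : ℕ} (hp : p + p = m + 1 + 1)
    (μ'' : HomologicalOrientation ℤ (ClosedModel (m + 1) (c.surgery ν hkl).W) (m + 1 + 1))
    (K : Set ↥(c.commonPiece ν)) (a b : relSingularCohomology ℤ ℤ (c.collapseTarget ν) ((c.ιZ ν '' K)ᶜ) p) :
    cupPairing μ'' hp
        (relSingularCohomology.toAbsolute ℤ ℤ _ _ p
          (relSingularCohomology.map ℤ ℤ (c.collapseP ν hkl) (c.mapsTo_collapseP ν hkl K) p a))
        (relSingularCohomology.toAbsolute ℤ ℤ _ _ p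
          (relSingularCohomology.map ℤ ℤ (c.collapseP ν hkl) (c.mapsTo_collapseP ν hkl K) p b)) =
      kroneckerPairing ℤ ℤ (c.collapseTarget ν) (m + 1 + 1)
        (cupProduct hp (relSingularCohomology.toAbsolute ℤ ℤ _ _ p a)
          (relSingularCohomology.toAbsolute ℤ ℤ _ _ p b))
        (singularHomology.map ℤ ℤ (c.collapseP ν hkl) (m + 1 + 1) μ''.fundamentalClass) := by
  rw [cupPairing_apply, relSingularCohomology.toAbsolute_map_apply,
    relSingularCohomology.toAbsolute_map_apply, ← cupProduct_map, kroneckerPairing_map]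

end Forms

/-! ### §2 The signature is unchanged (spheres of dimension `k ≤ p - 2`) -/

section Main

variable [CompactSpace M] [T2Space M] [Nonempty M] [ConnectedSpace M]

/-- **The signature is not changed by a surgery on a `k`-sphere with `k + 1 < p` in a
`(p + p)`-manifold bounded by `M`** (Kosinski 1993, X Prop. (3.3), p. 206: "`σ(M)` is an
invariant of cobordism"; Kervaire–Milnor 1963, §5–§7 with footnote pp. 528–529), for the
oriented null-cobordisms of the tree: given `(M, μ) = bW` (`c.IsOrientedBy μ μ'`, `M` closed
connected nonempty, `1 ≤ k`, `3 ≤ p`) there is an orientation `μ''` of the closed model of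
`χ = χ(W, φ)` with `(M, μ) = bχ` and `σ(χ̂, μ'') = σ(Ŵ, μ')`.  Proof (no duality): with the thin
collar and the compact `K₀ ⊆ U`, the cup product pairings of `Ŵ` and `χ̂` pull back ISOMETRICALLY
along the surjections `Hᵖ(Ŵ, Ŵ ∖ ι_X K₀) ↠ Hᵖ(Ŵ)`, `Hᵖ(χ̂, χ̂ ∖ ι_P K₀) ↠ Hᵖ(χ̂)` (exact sequences,
the ends having no `Hᵖ`) and the bijections `π^*`, `π'^*` to ONE module `Hᵖ(Z, Z ∖ K₀)`, where they
coincide (`kroneckerPairing_cupProduct_map_collapse_eq`); the index of a form is invariant under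
pull-back along surjections (`signature_eq_of_comp_surjective`), and `σ` is the index of the form
on `Hᵖ/T`, itself pulled back from `Hᵖ`. [cite: Kosinski1993, Ch. X §3, Prop. (3.3), p. 206] [cite: KervaireMilnorAnnals1963, §5 and §7, footnote pp. 528–529] -/
theorem signatureInDim_surgery_eq_of_lt {p : ℕ} (hp : p + p = m + 1 + 1) (h3p : 3 ≤ p)
    (hk : 1 ≤ k) (hkp : k + 1 < p)
    {μ : HomologicalOrientation ℤ M (m + 1)}
    {μ' : HomologicalOrientation ℤ (ClosedModel (m + 1) c.W) (m + 1 + 1)}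
    (hob : c.IsOrientedBy μ μ') :
    ∃ μ'' : HomologicalOrientation ℤ (ClosedModel (m + 1) (c.surgery ν hkl).W) (m + 1 + 1),
      (c.surgery ν hkl).IsOrientedBy μ μ'' ∧ μ''.signatureInDim hp = μ'.signatureInDim hp := by
  have hl : 2 ≤ l := by omega
  have hpl : p ≠ l := by omega
  have hpl' : p - 1 ≠ l := by omega
  have hpk : p ≠ k := by omega
  obtain ⟨w, w', μ'', -, -, hμ', hμ'', hob', hloc⟩ :=
    c.exists_isOrientedBy_surgery_local ν hkl hk hl hob
  refine ⟨μ'', hob', ?_⟩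
  -- a collar of `W` and a thin level off the closed tube; the compact `K₀ ⊆ U`
  obtain ⟨κ⟩ := BoundaryData.nonempty_collar_of_compactSpace m c.W c.boundaryData
  obtain ⟨ε, hε0, hε1, hthin⟩ := c.exists_collarBelow_disjoint κ (c.isCompact_closedUnitTube ν)
    (c.closedUnitTube_subset_interior ν hkl)
  have hK : IsCompact (c.K₀U ν κ ε) := c.isCompact_K₀U ν κ hε0 hε1
  -- the four maps
  set tX := (relSingularCohomology.toAbsolute ℤ ℤ (ClosedModel (m + 1) c.W)
    ((c.ιX ν hkl '' c.K₀U ν κ ε)ᶜ) p).hom with htXdef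
  set tP := (relSingularCohomology.toAbsolute ℤ ℤ (ClosedModel (m + 1) (c.surgery ν hkl).W)
    ((c.ιP ν hkl '' c.K₀U ν κ ε)ᶜ) p).hom with htPdef
  set πX := (relSingularCohomology.map ℤ ℤ (c.collapseX ν hkl)
    (c.mapsTo_collapseX ν hkl (c.K₀U ν κ ε)) p).hom with hπXdef
  set πP := (relSingularCohomology.map ℤ ℤ (c.collapseP ν hkl)
    (c.mapsTo_collapseP ν hkl (c.K₀U ν κ ε)) p).hom with hπPdef
  have htX : Surjective tX := c.surjective_toAbsolute_X ν hkl κ hε0 hε1 hthin (by omega) hpk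
  have htPs : Surjective tP := c.surjective_toAbsolute_P ν hkl κ hε0 hε1 hthin (by omega) hpl
  have htPi : Injective tP := c.injective_toAbsolute_P ν hkl κ hε0 hε1 hthin h3p hpl'
  have hπX : Bijective πX := c.bijective_relMap_collapseX ν hkl hK p
  have hπP : Bijective πP := c.bijective_relMap_collapseP ν hkl hK p
  -- finiteness of the modules
  obtain ⟨κP⟩ := BoundaryData.nonempty_collar_of_compactSpace m (c.surgery ν hkl).W
    (c.surgery ν hkl).boundaryData
  haveI := fun j => c.finite_singularHomology_closedModel κ j
  haveI := fun j => (c.surgery ν hkl).finite_singularHomology_closedModel κP j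
  haveI finX : Module.Finite ℤ (singularCohomology ℤ ℤ (ClosedModel (m + 1) c.W) p) :=
    finite_singularCohomology_of_finite_singularHomology p fun j _ => inferInstance
  haveI finP : Module.Finite ℤ (singularCohomology ℤ ℤ (ClosedModel (m + 1) (c.surgery ν hkl).W) p) :=
    finite_singularCohomology_of_finite_singularHomology p fun j _ => inferInstance
  haveI : Module.Finite ℤ (freeCohomology ℤ (ClosedModel (m + 1) c.W) p) :=
    c.finite_freeCohomology_closedModel κ p
  haveI : Module.Finite ℤ (freeCohomology ℤ (ClosedModel (m + 1) (c.surgery ν hkl).W) p) :=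
    (c.surgery ν hkl).finite_freeCohomology_closedModel κP p
  haveI finFP : Module.Finite ℤ (relSingularCohomology ℤ ℤ (ClosedModel (m + 1) (c.surgery ν hkl).W)
      ((c.ιP ν hkl '' c.K₀U ν κ ε)ᶜ) p) := Module.Finite.of_injective tP htPi
  haveI finFZ : Module.Finite ℤ (relSingularCohomology ℤ ℤ (c.collapseTarget ν)
      ((c.ιZ ν '' c.K₀U ν κ ε)ᶜ) p) := Module.Finite.of_injective πP hπP.1
  haveI finFX : Module.Finite ℤ (relSingularCohomology ℤ ℤ (ClosedModel (m + 1) c.W)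
      ((c.ιX ν hkl '' c.K₀U ν κ ε)ᶜ) p) := Module.Finite.of_surjective πX hπX.2
  -- the forms on `Hᵖ(Z, Z ∖ K₀)` agree
  set BX : LinearMap.BilinForm ℤ (singularCohomology ℤ ℤ (ClosedModel (m + 1) c.W) p) :=
    cupPairing μ' hp with hBX
  set BP : LinearMap.BilinForm ℤ (singularCohomology ℤ ℤ (ClosedModel (m + 1) (c.surgery ν hkl).W) p) :=
    cupPairing μ'' hp with hBP
  have hagree : ∀ a b, BX (tX (πX a)) (tX (πX b)) = BP (tP (πP a)) (tP (πP b)) := by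
    intro a b
    rw [hBX, hBP, htXdef, hπXdef, htPdef, hπPdef]
    refine (c.cupPairing_toAbsolute_relMap_collapseX ν hkl hp μ' _ a b).trans
      (Eq.trans ?_ (c.cupPairing_toAbsolute_relMap_collapseP ν hkl hp μ'' _ a b).symm)
    exact kroneckerPairing_cupProduct_map_collapse_eq hμ' hμ'' hloc hK hp _ _
      (relSingularCohomology.map_subsetIncl_toAbsolute _ p a)
  -- the chain of indices
  have e1 : μ'.signatureInDim hp = BX.signature := by
    rw [HomologicalOrientation.signatureInDim_def]
    exact (LinearMap.BilinForm.signature_eq_of_comp_surjective BX (intersectionForm hp μ')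
      freeCohomology.mk (fun x y => intersectionForm_mk_mk hp μ' x y) freeCohomology.mk_surjective).symm
  set BZX : LinearMap.BilinForm ℤ (relSingularCohomology ℤ ℤ (c.collapseTarget ν)
      ((c.ιZ ν '' c.K₀U ν κ ε)ᶜ) p) := BX.compl₁₂ (tX ∘ₗ πX) (tX ∘ₗ πX) with hBZX
  set BZP : LinearMap.BilinForm ℤ (relSingularCohomology ℤ ℤ (c.collapseTarget ν)
      ((c.ιZ ν '' c.K₀U ν κ ε)ᶜ) p) := BP.compl₁₂ (tP ∘ₗ πP) (tP ∘ₗ πP) with hBZP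
  have e2 : BZX.signature = BX.signature :=
    LinearMap.BilinForm.signature_eq_of_comp_surjective BZX BX (tX ∘ₗ πX) (fun x y => rfl)
      (htX.comp hπX.2)
  have e3 : μ''.signatureInDim hp = BP.signature := by
    rw [HomologicalOrientation.signatureInDim_def]
    exact (LinearMap.BilinForm.signature_eq_of_comp_surjective BP (intersectionForm hp μ'')
      freeCohomology.mk (fun x y => intersectionForm_mk_mk hp μ'' x y) freeCohomology.mk_surjective).symm
  have e4 : BZP.signature = BP.signature :=
    LinearMap.BilinForm.signature_eq_of_comp_surjective BZP BP (tP ∘ₗ πP) (fun x y => rfl)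
      (htPs.comp hπP.2)
  have e5 : BZX = BZP := by
    refine LinearMap.ext fun a => LinearMap.ext fun b => ?_
    exact hagree a b
  rw [e1, e3, ← e2, ← e4, e5]

end Main

end NullCobordism

end Literature.Topology.FourManifolds
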